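import Summits.ResolutionOfSingularities.ResolutionOfSingularities.Theorems.MarkedTransferCampaignW46ExitTree
import Literature.AlgebraicGeometry.Resolution.BaseTreeFiniteKonig
import HarnessLib

/-!
# Infinite branches of the marked quadratic tree, I: bookkeeping along a chain of marked steps

[OURS · L1 W4.6 rung (i-a)′, INVARIANT layer — cell res-hironaka, LADDER-RESOLUTION rung L, D-0089; campaign s46,
seat res-D-pv-044 AS res-L1-s46-pv-8; host route MarkedTransfer, `--supports stmt-ResolutionOfSingularities-16156
--as helper`.] HONEST FRAMING: nothing here is a statement of H. Hironaka's manuscript (2017-03-23, [Hironaka2017]);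
pure commutative algebra inside a field `K`, continuing `MarkedTransferCampaignW46ExitTree.lean` (the hypothesis of
`finite_exitTree_of_no_infinite_branch`, `…ExitTreeKonig.lean`, is the absence of an infinite sequence of marked steps;
this file and its sequels derive a contradiction from such a sequence). AI-written; weaker than expert review. No
`sorry`; axioms standard.

For a sequence `c : ℕ → MarkedNode K` of marked steps `c i → c (i+1)` (`S_i = (c i).1` two-dimensional regular local
rings of `K`, `S_{i+1}` a first quadratic transform of `S_i`, `I_{i+1} = (I_i S_{i+1} : (𝔪_i S_{i+1})^b)`,
`I_i ⊆ 𝔪_i^b`, `I_i ⊄ 𝔪_i^{2b}`), PROVED: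

* `Chain.*` — members are distinct two-dimensional regular local rings of `K`, strictly increasing;
* `Chain.exists_chart` — a chart element `x_i ∈ 𝔪_i` with `𝔪_i S_{i+1} = x_i S_{i+1}`;
* `Chain.extIdeal_snd_succ` — `I_i S_{i+1} = x_i^b · I_{i+1}`; `Chain.extIdeal_snd_zero` — `I_0 S_i = a_i · I_i` with
  `a_i ≠ 0` (telescoping), so `I_i` is principal iff `I_0 S_i` is;
* `Chain.exists_forall_isPrincipal` — **Zariski's principalization along the chain**: `I_i` is principal for all
  large `i` (the tree's `finite_idealBaseTree_of_isRegularLocalRing`, the members being distinct iterated quadratic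
  transforms of `S_0`);
* `Chain.exists_valuationSubring` — a valuation ring `W` of `K` dominating every member, along which every step is
  the quadratic transform, with `W = ⋃ S_i` (Chevalley + Abhyankar's union lemma, the tree's
  `exists_valuationSubring_subringDominates_chain` and `AbhyankarQuadraticUnion_holds`).

## References

* O. Zariski, P. Samuel, *Commutative Algebra* II (1960), Appendix 5. [ZariskiSamuel1960]
* S. S. Abhyankar, *On the valuations centered in a local domain*, Amer. J. Math. 78 (1956), Lemma 12.
  [Abhyankar1956Valuations]
-/

noncomputable section

open IsLocalRing

-- single-problem summit: the doubled namespace component `ResolutionOfSingularities` is forced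
set_option linter.dupNamespace false

namespace Summit.ResolutionOfSingularities.ResolutionOfSingularities.Theorems.CampaignW46

open Literature.AlgebraicGeometry.Resolution

universe u

variable {K : Type u} [Field K] {b : ℕ}

/-! ## An ideal inside a principal ideal is the generator times its controlled transform -/

/-- `J ⊆ (a)` ⇒ `J = (a) · (J : (a))`. [folklore] -/
theorem eq_span_singleton_mul_colon_span {D : Type*} [CommRing D] {a : D} {N : Ideal D}
    (h : N ≤ Ideal.span {a}) :
    N = Ideal.span {a} * Submodule.colon N ((Ideal.span {a} : Ideal D) : Set D) := by
  rw [Ideal.colon_span]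
  exact eq_span_singleton_mul_colon h

namespace Chain

variable {c : ℕ → MarkedNode K} (hc : ∀ i, MarkedStep b (c i) (c (i + 1)))
include hc

/-! ## The members of a chain -/

/-- Every member of a chain is a tame node. [folklore] -/
theorem isTameNode (i : ℕ) : IsTameNode b (c i) := (hc i).isTameNode

/-- Members are regular local rings. [folklore] -/
theorem isRegularLocalRing (i : ℕ) : IsRegularLocalRing (c i).1 := by
  obtain ⟨h, -⟩ := (hc i).isTameNode; exact h

/-- Members are two-dimensional. [folklore] -/
theorem ringKrullDim_eq (i : ℕ) : ringKrullDim (c i).1 = 2 := by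
  obtain ⟨_, h, -⟩ := (hc i).isTameNode; exact h

/-- Members have fraction field `K`. [folklore] -/
theorem isLocalRingOf (i : ℕ) : IsLocalRingOf (c i).1 := by
  obtain ⟨_, -, h, -⟩ := (hc i).isTameNode; exact h

/-- Consecutive members are quadratic transforms. [folklore] -/
theorem isQuadraticTransform (i : ℕ) : IsQuadraticTransform (c i).1 (c (i + 1)).1 :=
  (hc i).isQuadraticTransform

/-- The marked ideal has order `≥ b`. [folklore] -/
theorem snd_le_pow (i : ℕ) :
    haveI := (isRegularLocalRing hc i).toIsLocalRing
    (c i).2 ≤ maximalIdeal (c i).1 ^ b := by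
  obtain ⟨_, -, -, h, -⟩ := (hc i).isTameNode; exact h

/-- The marked ideal has order `< 2b`. [folklore] -/
theorem snd_not_le_pow (i : ℕ) :
    haveI := (isRegularLocalRing hc i).toIsLocalRing
    ¬ (c i).2 ≤ maximalIdeal (c i).1 ^ (2 * b) := by
  obtain ⟨_, -, -, -, h⟩ := (hc i).isTameNode; exact h

/-- The transported ideal is the controlled transform. [folklore] -/
theorem snd_succ (i : ℕ) :
    haveI := (isRegularLocalRing hc i).toIsLocalRing
    (c (i + 1)).2 = ctrlTransform b (c i).1 (c i).2 (c (i + 1)).1 :=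
  (hc i).snd_eq _

/-- The chain is monotone. [folklore] -/
theorem le_succ (i : ℕ) : (c i).1 ≤ (c (i + 1)).1 := (isQuadraticTransform hc i).dominates.1

/-- The chain is monotone. [folklore] -/
theorem monotone : Monotone fun i => (c i).1 := monotone_nat_of_le_succ (le_succ hc)

/-- Later members dominate earlier ones. [folklore] -/
theorem subringDominates {i j : ℕ} (hij : i ≤ j) : SubringDominates (c i).1 (c j).1 := by
  induction hij with
  | refl => exact SubringDominates.refl _
  | step _ ih => exact ih.trans (isQuadraticTransform hc _).dominates

/-- Later members are iterated quadratic transforms of earlier ones. [folklore] -/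
theorem reflTransGen {i j : ℕ} (hij : i ≤ j) :
    Relation.ReflTransGen IsQuadraticTransform (c i).1 (c j).1 := by
  induction hij with
  | refl => exact Relation.ReflTransGen.refl
  | step _ ih => exact ih.tail (isQuadraticTransform hc _)

/-- Consecutive members are distinct. [folklore] -/
theorem ne_succ (i : ℕ) : (c i).1 ≠ (c (i + 1)).1 :=
  haveI := isRegularLocalRing hc i
  (isQuadraticTransform hc i).ne fun _ z => maximalIdeal_ne_span_singleton (ringKrullDim_eq hc i) z

/-- **The members of a chain are pairwise distinct.** [folklore] -/
theorem injective : Function.Injective fun i => (c i).1 := by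
  intro i j hij
  by_contra hne
  wlog hlt : i < j generalizing i j
  · exact this hij.symm (Ne.symm hne) (lt_of_le_of_ne (not_lt.mp hlt) (Ne.symm hne))
  -- `S_i ≤ S_{i+1} ≤ S_j = S_i`
  have h1 : (c (i + 1)).1 ≤ (c j).1 := monotone hc (Nat.succ_le_of_lt hlt)
  have h2 : (c j).1 = (c i).1 := hij.symm
  exact ne_succ hc i (le_antisymm (le_succ hc i) (h2 ▸ h1))

/-! ## Chart elements and the telescoping of the marked ideals -/

/-- **A chart element**: `x ∈ 𝔪_i`, `x ≠ 0`, with `𝔪_i S_{i+1} = x S_{i+1}` (every non-unit `y` of `S_i` has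
`y/x ∈ S_{i+1}`). [folklore] -/
theorem exists_chart (i : ℕ) :
    ∃ x : K, x ∈ (c i).1 ∧ x ≠ 0 ∧ x⁻¹ ∉ (c i).1 ∧
      (∀ y ∈ (c i).1, y⁻¹ ∉ (c i).1 → y / x ∈ (c (i + 1)).1) ∧
      ∀ hx : x ∈ (c (i + 1)).1,
        haveI := (isRegularLocalRing hc i).toIsLocalRing
        extIdeal (maximalIdeal (c i).1) (c (i + 1)).1 = Ideal.span {⟨x, hx⟩} := by
  haveI := isRegularLocalRing hc i
  obtain ⟨_, x, hxm, hx0, _, hT, -, hdom⟩ := isQuadraticTransform hc i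
  have hx0K : ((x : (c i).1) : K) ≠ 0 := fun e => hx0 (Subtype.ext e)
  have hxinv : ((x : (c i).1) : K)⁻¹ ∉ (c i).1 := fun h =>
    ((mem_maximalIdeal_iff_inv_not_mem x).mp hxm).elim hx0K (· h)
  have hdiv : ∀ y ∈ (c i).1, y⁻¹ ∉ (c i).1 → y / (x : K) ∈ (c (i + 1)).1 := fun y hy hyinv => by
    have hym : (⟨y, hy⟩ : (c i).1) ∈ maximalIdeal (c i).1 := by
      rw [mem_maximalIdeal_iff_inv_not_mem]; exact Or.inr hyinv
    exact hT (div_mem_blowupRing (x : K) hym)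
  refine ⟨x, x.2, hx0K, hxinv, hdiv, fun hx => ?_⟩
  apply le_antisymm
  · rw [extIdeal_eq_map _ hdom.1, Ideal.map_le_iff_le_comap]
    intro y hy
    rw [Ideal.mem_comap, Ideal.mem_span_singleton']
    rcases (mem_maximalIdeal_iff_inv_not_mem y).mp hy with hy0 | hyinv
    · refine ⟨0, Subtype.ext ?_⟩
      change (0 : K) * x = ((y : (c i).1) : K)
      rw [hy0, zero_mul]
    · refine ⟨⟨(y : K) / x, hdiv _ y.2 hyinv⟩, Subtype.ext ?_⟩
      change (y : K) / x * x = (y : K)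
      rw [div_mul_cancel₀ _ hx0K]
  · rw [Ideal.span_singleton_le_iff_mem, extIdeal_eq_map _ hdom.1]
    exact Ideal.mem_map_of_mem (Subring.inclusion hdom.1) hxm

/-- **One step of the telescoping**: for a chart element `x` of the step `i`, `I_i S_{i+1} = x^b · I_{i+1}`.
[folklore] -/
theorem extIdeal_snd_succ (i : ℕ) {x : K} (hx : x ∈ (c (i + 1)).1)
    (hxm : haveI := (isRegularLocalRing hc i).toIsLocalRing
      extIdeal (maximalIdeal (c i).1) (c (i + 1)).1 = Ideal.span {⟨x, hx⟩}) :
    extIdeal (c i).2 (c (i + 1)).1 = Ideal.span {(⟨x, hx⟩ : (c (i + 1)).1) ^ b} * (c (i + 1)).2 := by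
  haveI := isRegularLocalRing hc i
  have hle : extIdeal (c i).2 (c (i + 1)).1 ≤ Ideal.span {(⟨x, hx⟩ : (c (i + 1)).1) ^ b} := by
    rw [← Ideal.span_singleton_pow, ← hxm, extIdeal_eq_map _ (le_succ hc i), extIdeal_eq_map _ (le_succ hc i),
      ← Ideal.map_pow]
    exact Ideal.map_mono (snd_le_pow hc i)
  have h := eq_span_singleton_mul_colon_span hle
  rw [snd_succ hc i, ctrlTransform, hxm, Ideal.span_singleton_pow]
  exact h

/-- **Telescoping**: `I_0 S_i = a · I_i` for some `a ≠ 0`. [folklore] -/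
theorem extIdeal_snd_zero (i : ℕ) :
    ∃ a : (c i).1, a ≠ 0 ∧ extIdeal (c 0).2 (c i).1 = Ideal.span {a} * (c i).2 := by
  induction i with
  | zero =>
    refine ⟨1, one_ne_zero, ?_⟩
    rw [Ideal.span_singleton_one, Ideal.top_mul, extIdeal_eq_map _ le_rfl]
    have : Subring.inclusion (le_refl (c 0).1) = RingHom.id _ := RingHom.ext fun _ => rfl
    rw [this, Ideal.map_id]
  | succ i ih =>
    obtain ⟨a, ha0, ha⟩ := ih
    obtain ⟨x, hxS, hx0, -, -, hxm⟩ := exists_chart hc i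
    have hx : x ∈ (c (i + 1)).1 := le_succ hc i hxS
    have hstep := extIdeal_snd_succ hc i hx (hxm hx)
    have h0i : (c 0).1 ≤ (c i).1 := monotone hc (Nat.zero_le i)
    refine ⟨Subring.inclusion (le_succ hc i) a * (⟨x, hx⟩ : (c (i + 1)).1) ^ b, ?_, ?_⟩
    · refine mul_ne_zero ?_ (pow_ne_zero _ fun e => hx0 (congrArg Subtype.val e))
      intro e
      exact ha0 (Subtype.ext (congrArg (fun z : (c (i + 1)).1 => (z : K)) e))
    · rw [← map_extIdeal (c 0).2 h0i (le_succ hc i), ha, Ideal.map_mul, Ideal.map_span, Set.image_singleton,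
        ← extIdeal_eq_map _ (le_succ hc i), hstep, ← mul_assoc, Ideal.span_singleton_mul_span_singleton]

/-- `I_i` is principal iff `I_0 S_i` is. [folklore] -/
theorem isPrincipal_snd_iff (i : ℕ) :
    ((c i).2).IsPrincipal ↔ (extIdeal (c 0).2 (c i).1).IsPrincipal := by
  obtain ⟨a, ha0, ha⟩ := extIdeal_snd_zero hc i
  rw [ha, isPrincipal_span_singleton_mul_iff ha0]

/-! ## Zariski: the marked ideals are eventually principal -/

/-- **Principalization along the chain**: `I_i` is principal for all large `i` — the members are distinct
iterated quadratic transforms of `S_0`, and only finitely many of those fail to principalize `I_0`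
(`finite_idealBaseTree_of_isRegularLocalRing`). [cite: ZariskiSamuel1960, Appendix 5] -/
theorem exists_forall_isPrincipal : ∃ N, ∀ i, N ≤ i → ((c i).2).IsPrincipal := by
  classical
  haveI := isRegularLocalRing hc 0
  have hfin := finite_idealBaseTree_of_isRegularLocalRing (c 0).1 (ringKrullDim_eq hc 0) (isLocalRingOf hc 0)
    (c 0).2
  -- the bad indices embed into the base tree
  have hbad : {i : ℕ | ¬ ((c i).2).IsPrincipal}.Finite := by
    refine (hfin.preimage (injective hc).injOn).subset fun i hi => ?_
    exact ⟨reflTransGen hc (Nat.zero_le i), fun hp => hi ((isPrincipal_snd_iff hc i).mpr hp)⟩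
  obtain ⟨N, hN⟩ := hbad.bddAbove
  refine ⟨N + 1, fun i hi => ?_⟩
  by_contra hnp
  have := hN hnp
  omega

/-! ## The valuation ring of the chain -/

/-- **The valuation ring of an infinite chain**: some valuation ring `W` of `K` dominates every member; every step
is the quadratic transform along `W`; and `W` is the union of the members (Abhyankar's union lemma).
[cite: Abhyankar1956Valuations, Lemma 12] -/
theorem exists_valuationSubring :
    ∃ W : ValuationSubring K, (∀ i, SubringDominates (c i).1 W.toSubring) ∧
      (∀ i, IsQuadraticTransformAlong W (c i).1 (c (i + 1)).1) ∧ ∀ z : K, z ∈ W ↔ ∃ i, z ∈ (c i).1 := by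
  have hloc : ∀ i, IsLocalRing (c i).1 := fun i => (isRegularLocalRing hc i).toIsLocalRing
  obtain ⟨W, hW⟩ := exists_valuationSubring_subringDominates_chain (fun i => (c i).1) hloc
    fun i => (isQuadraticTransform hc i).dominates
  have halong : ∀ i, IsQuadraticTransformAlong W (c i).1 (c (i + 1)).1 := fun i => by
    haveI := isRegularLocalRing hc i
    exact (isQuadraticTransform hc i).along ⟨inferInstance, IsNoetherian.noetherian _⟩ (hW (i + 1))
  haveI := isRegularLocalRing hc 0
  exact ⟨W, hW, halong, AbhyankarQuadraticUnion_holds K W (fun i => (c i).1) inferInstance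
    (ringKrullDim_eq hc 0) (isLocalRingOf hc 0) (hW 0) halong⟩

end Chain

end Summit.ResolutionOfSingularities.ResolutionOfSingularities.Theorems.CampaignW46

end
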